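import Summits.CriticalPhenomena.PercolationContinuityZ3.Theorems.PercNearOneGluingNoHeavyLowerTailFKCSHUnfoldMain
import Summits.CriticalPhenomena.PercolationContinuityZ3.Theorems.PercNearOneGluingNoHeavyLowerTailFKCSHToAdditiveGluing
import HarnessLib

/-!
# FK sub-lane: THE FK FINITE LEG ASSEMBLED — `AdditiveGluingFK q` (q ≥ 1) from the two located statements `PhiFKMonotone q` and `HpartFK q`,
# and the end-to-end `q = 1` regression (the crux `AdditiveGluing` re-derived through the FK chain)

Support file (`--supports stmt-CriticalPhenomena-4575`), FK sub-lane `prim-bschramm-fk-1` (gen 2) of the post-continuity programme;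
builds on p205010 (kernel theorem, internal audit signed; external expert review pending).  No definitions, no named facts, no sorries;
standard axioms.

* **`FK.additiveGluingFK_of_hpartFK_of_phiFKMonotone : 1 ≤ q → FK.PhiFKMonotone q → FK.HpartFK q → FK.AdditiveGluingFK q`** —
  Kozma–Nitzan's additive gluing for the random-cluster measures `φ_{w,q}` on every finite weighted graph, from Lemma Φ(b)_FK and Lemma H_FK
  (both typed, parametrised by `q`, NOT asserted; exact-census clean, bschramm/FK-DEFS.md §6): chain `FK.cshFK_of_hpartFK_of_phiFKMonotone`
  (Lemma T_rc + MDL(X)_FK + induction + Lemma U_FK) then `FK.additiveGluingFK_of_cshFK` (peeling + fk-2's upper chain + closure);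
* `FK.nearOneGluingFK_of_hpartFK_of_phiFKMonotone` — Kozma–Nitzan's Conjecture 3 for `φ_{w,q}` likewise;
* `q = 1` REGRESSION: `FK.additiveGluingFK_one_holds : AdditiveGluingFK 1` from `FK.phiFKMonotone_one` and `FK.hpartFK_one` through the FK
  chain, and `example : PercNearOneGluing.AdditiveGluing` — the route crux re-derived end to end through the random-cluster port at `q = 1`
  (builds on p205010 (kernel theorem, internal audit signed; external expert review pending)).
For `q > 1` NOTHING is asserted: `PhiFKMonotone q` (fk-1 gen 2, open) and `HpartFK q` ((K6)_rc tree + (Htw)_FK open, fk-2) are the two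
remaining mathematical statements of the FK finite leg.
[cite: KozmaNitzan2024, Conj. 1 (p. 3), Conj. 3 (p. 15), Conj. 4 (p. 32)] [cite: VandenbergHaggstromKahn2005, §2.1 (pp. 9–13)] [cite: Grimmett2006, §1.4 eq. (1.20) (p. 15)]
-/

noncomputable section

namespace Summit.CriticalPhenomena.PercolationContinuityZ3.Theorems

open MeasureTheory Set Literature.Probability.LatticeModels Literature.Probability.Percolation
open scoped Classical

namespace FK

/-- **FK additive gluing from the two located statements** (`q ≥ 1`). [cite: KozmaNitzan2024, Conj. 1 (p. 3)] -/
theorem additiveGluingFK_of_hpartFK_of_phiFKMonotone {q : ℝ} (hq : 1 ≤ q) (hΦ : PhiFKMonotone q) (hH : HpartFK q) :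
    AdditiveGluingFK q :=
  additiveGluingFK_of_cshFK hq (cshFK_of_hpartFK_of_phiFKMonotone hq hΦ hH)

/-- **FK near-one gluing (Kozma–Nitzan Conjecture 3 for `φ_{w,q}`) from the two located statements** (`q ≥ 1`).
[cite: KozmaNitzan2024, Conj. 3 (p. 15)] -/
theorem nearOneGluingFK_of_hpartFK_of_phiFKMonotone {q : ℝ} (hq : 1 ≤ q) (hΦ : PhiFKMonotone q) (hH : HpartFK q) :
    NearOneGluingFK q :=
  nearOneGluingFK_of_additiveGluingFK q (additiveGluingFK_of_hpartFK_of_phiFKMonotone hq hΦ hH)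

/-- **`q = 1` REGRESSION**: FK additive gluing at `q = 1` through the whole random-cluster port (`FK.phiFKMonotone_one`, `FK.hpartFK_one`,
Lemma T_rc, MDL(X)_FK, Lemma U_FK, peeling, upper chain, closure). [cite: KozmaNitzan2024, Conj. 1 (p. 3)] -/
theorem additiveGluingFK_one_holds : AdditiveGluingFK 1 :=
  additiveGluingFK_of_hpartFK_of_phiFKMonotone le_rfl phiFKMonotone_one hpartFK_one

/-- The route crux `AdditiveGluing` re-derived end to end through the FK chain at `q = 1` (an `example`: the statement is the tree's
`CSH.additiveGluing_holds`; builds on p205010 (kernel theorem, internal audit signed; external expert review pending)).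
[cite: KozmaNitzan2024, Conj. 1 (p. 3)] -/
example : Summit.CriticalPhenomena.PercolationContinuityZ3.Theses.PercNearOneGluing.AdditiveGluing :=
  additiveGluingFK_one_iff.1 additiveGluingFK_one_holds

end FK

end Summit.CriticalPhenomena.PercolationContinuityZ3.Theorems

end
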